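import Summits.QuantumAdvantage.QuantumAdvantage.Theorems.LinnikCubicClassGroupsDegreeOnePrimesEscapeTatuzawa
import Literature.NumberTheory.QuadraticFields.QuadraticDedekindZeta
import Literature.NumberTheory.NumberFields.ArithmeticEquivalenceThm1Proofs
import Literature.NumberTheory.NumberFields.ArithmeticEquivalenceSolitaryProofs
import HarnessLib

/-!
# The exceptional quadratic field is unique up to isomorphism; Tatuzawa's class-number theorem,
# explicit

Topic `Summits/QuantumAdvantage/QuantumAdvantage/Theorems`, cell B2b-1 (linnik-cubic), PART A (gen 26);
helper toward the crux `DegreeOnePrimesEscape` (stmt-QuantumAdvantage-11543) of route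
`LinnikCubicClassGroups`.  HONEST FRAMING: the value of this file is a THEOREM (kernel-checked, explicit
constants) — NOT summit progress.

`…DegreeOnePrimesEscapeTatuzawa.lean` shows: a real zero `β` of `ζ_K` with
`1 − β < C([K:ℚ],ε)|d_K|^{-ε}` (`C(n,ε) = C_T ε⁵/(1000·n!)`, `C_T = c_E/(2592 B)`, explicit) comes from a
quadratic subfield, and two such fields have quadratic subfields of the same `|d_k|`.  Here the
conclusion is sharpened to ISOMORPHISM and freed from the choice of the subfield:

* `tatuzawa_violation_of_quadraticSubfield` — for ANY quadratic `k ⊆ K` with `ζ_k(β) = 0` and any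
  Kronecker character `κ` of `k` (`ζ_k = ζ·L(κ)` on `Re s > 1`, `exists_primitive_kroneckerChar`), `κ`
  violates Tatuzawa's bound at level `4ε/5`;
* `dedekindZeta_eq_of_kroneckerChar_eq` — two number fields whose zeta functions factor as `ζ·L(κ)`
  through the SAME character have the same Dedekind zeta function (as `L`-series: coefficientwise,
  Mathlib `LSeries.eq_of_LSeries_eventually_eq`);
* `nonempty_algEquiv_quadraticSubfield_of_close_zeros` — **if `K`, `K'` (any degrees `> 1`) have real
  zeros `β`, `β'` that close to `1`, then every quadratic `k ⊆ K` with `ζ_k(β) = 0` and every quadratic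
  `k' ⊆ K'` with `ζ_{k'}(β') = 0` are ISOMORPHIC** (Tatuzawa: the two Kronecker characters have the same
  modulus — `tatuzawa_of_ne` — and then coincide — `tatuzawa_sameLevel`; hence `ζ_k = ζ_{k'}`, so `k`,
  `k'` are arithmetically equivalent (Perlis 1977 Thm 1, tree `Perlis1977_thm1_holds`) and, being of
  degree `2 ≤ 6`, isomorphic (Perlis Thm 3, `Perlis1977_thm3_holds`));
* `exists_reference_exceptional_quadraticField` — **given one field `K₁` with such a close zero `β₁`,
  there is a quadratic `k₁ ⊆ K₁` with `ζ_{k₁}(β₁) = 0` such that EVERY number field `K` of degree `n > 1`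
  admitting no embedding `k₁ → K` has `1 − β ≥ C(n,ε)|d_K|^{-ε}` for all real zeros `β < 1` of `ζ_K`**
  — at each scale `ε` the Siegel-zero obstruction is carried by ONE quadratic field up to isomorphism;
* `exists_tatuzawa_exceptional_classNumber_mul_regulator_quadratic`,
  `exists_tatuzawa_exceptional_classNumber_imaginaryQuadratic` — the degree-2 case of the explicit
  Brauer–Siegel bound: `h_K R_K ≥ e^{-7}(32π)^{-2}(C_T ε⁵/4000)|d_K|^{1/2−ε}` for every quadratic `K`
  with `|d_K| ≠ M₀(ε)`, and `h_K ≥` the same for imaginary quadratic `K` (`R_K = 1`) — Tatuzawa's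
  Theorem 1 (`h(−d) > 0.655 ε d^{1/2−ε}/π` with one exception) in kernel-checked explicit form.
[Tatuzawa1951, Thms 1–2] [Stark1974, Thm 3] [Perlis1977, Thms 1, 3] [Siegel1935].  0 sorries, standard axioms.
-/

noncomputable section

open Complex NumberField NumberField.Units Module Filter

namespace Summit.QuantumAdvantage.QuantumAdvantage.Theorems.DegreeOnePrimesEscape

open Literature.NumberTheory.LFunctions Literature.NumberTheory.LFunctions.NumberField
  Literature.NumberTheory.LFunctions.Siegel Literature.NumberTheory.QuadraticFields
  Literature.NumberTheory.NumberFields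

/-- **Any quadratic subfield carrying the close zero violates Tatuzawa's bound.**  Let `K` have degree
`n > 1`, `0 < ε ≤ 1`, `β < 1` with `1 − β < C(n,ε)|d_K|^{-ε}`, `k ⊆ K` quadratic with `ζ_k(β) = 0`, and
`κ` mod `M = |d_k|` a non-principal character with `ζ_k = ζ·L(κ)` on `Re s > 1`.  Then
`Re L(1,κ) < C_T ε'³ M^{-ε'}`, `ε' = 4ε/5` (`L(β,κ) = 0` as `ζ(β) < 0`; `M ≤ |d_K|`; mean value
`L(1,κ) ≤ (1−β)·288|d_K|^{ε'/4}/ε'²`). [cite: Tatuzawa1951, Theorem 2]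
[cite: MontgomeryVaughan2007, §11.2 Corollary 11.15 (proof)] -/
theorem tatuzawa_violation_of_quadraticSubfield (K : Type) [Field K] [NumberField K]
    (hK : 1 < finrank ℚ K) {ε : ℝ} (hε : 0 < ε) (hε1 : ε ≤ 1) {β : ℝ} (hβ1 : β < 1)
    (hclose : 1 - β < (Estermann.estermannC / (2592 * ballConst) * ε ^ 5 /
      (1000 * ((finrank ℚ K).factorial : ℝ))) * ((discr K).natAbs : ℝ) ^ (-ε))
    (k : IntermediateField ℚ K) (hk2 : finrank ℚ k = 2) (hkζ : dedekindZetaCont k β = 0)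
    {M : ℕ} [NeZero M] (κ : DirichletCharacter ℂ M) (hκ1 : κ ≠ 1) (hM : M = (discr k).natAbs)
    (hfac : ∀ s : ℂ, 1 < s.re →
      NumberField.dedekindZeta k s = riemannZeta s * LSeries (fun m ↦ κ m) s) :
    (κ.LFunction 1).re <
      Estermann.estermannC / (2592 * ballConst) * (4 * ε / 5) ^ 3 * (M : ℝ) ^ (-(4 * ε / 5)) := by
  set n : ℕ := finrank ℚ K with hn
  set d : ℝ := ((discr K).natAbs : ℝ) with hd
  have hdK : 3 ≤ (discr K).natAbs := three_le_natAbs_discr K hK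
  have hd3 : (3 : ℝ) ≤ d := by rw [hd]; exact_mod_cast hdK
  have hd0 : (0 : ℝ) < d := by linarith
  have hd1 : (1 : ℝ) ≤ d := by linarith
  have hlogd : 0 < Real.log d := Real.log_pos (by linarith)
  have hfac0 : (0 : ℝ) < (n.factorial : ℝ) := by exact_mod_cast Nat.factorial_pos n
  have hCT0 : 0 < Estermann.estermannC / (2592 * ballConst) := by
    have := Estermann.estermannC_pos; have := one_le_ballConst; positivity
  have hCT1 := tatuzawa_const_le_one
  set CT : ℝ := Estermann.estermannC / (2592 * ballConst) with hCTdef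
  set C : ℝ := CT * ε ^ 5 / (1000 * (n.factorial : ℝ)) with hCdef
  have hC0 : 0 < C := by positivity
  have hfac1 : (1 : ℝ) ≤ (n.factorial : ℝ) := by exact_mod_cast Nat.one_le_iff_ne_zero.mpr (Nat.factorial_ne_zero n)
  have hε4 : ε ^ 4 ≤ 1 := by
    have : ε ^ 4 ≤ 1 ^ 4 := pow_le_pow_left₀ hε.le hε1 4
    simpa using this
  have hCle1 : C ≤ CT * (4 * ε / 5) ^ 5 / 288 := by
    rw [hCdef]
    have h1 : CT * ε ^ 5 / (1000 * (n.factorial : ℝ)) ≤ CT * ε ^ 5 / 1000 := by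
      apply div_le_div_of_nonneg_left (by positivity) (by norm_num)
      nlinarith
    have h2 : CT * ε ^ 5 / 1000 ≤ CT * (4 * ε / 5) ^ 5 / 288 := by
      rw [show CT * (4 * ε / 5) ^ 5 / 288 = CT * ε ^ 5 * (1024 / 900000) by ring,
        show CT * ε ^ 5 / 1000 = CT * ε ^ 5 * (1 / 1000) by ring]
      exact mul_le_mul_of_nonneg_left (by norm_num) (by positivity)
    exact h1.trans h2
  have hCle2 : C ≤ ε / (4 * (n.factorial : ℝ)) := by
    rw [hCdef, div_le_div_iff₀ (by positivity) (by positivity)]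
    -- `CT ε⁵ · 4 n! ≤ ε · 1000 n!`
    have : CT * ε ^ 4 ≤ 1 := by nlinarith
    have h0 : (0 : ℝ) ≤ ε * (n.factorial : ℝ) := by positivity
    nlinarith
  have hCle3 : C ≤ ε / 20 := by
    rw [hCdef, div_le_div_iff₀ (by positivity) (by norm_num)]
    have : CT * ε ^ 4 ≤ 1 := by nlinarith
    have h0 : (0 : ℝ) ≤ ε := hε.le
    nlinarith
  have hdε1 : d ^ (-ε) ≤ 1 := Real.rpow_le_one_of_one_le_of_nonpos hd1 (by linarith)
  have hdε0 : 0 < d ^ (-ε) := Real.rpow_pos_of_pos hd0 _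
  have h1βC : 1 - β < C := by
    calc 1 - β < C * d ^ (-ε) := hclose
      _ ≤ C * 1 := mul_le_mul_of_nonneg_left hdε1 hC0.le
      _ = C := mul_one C
  have hβ0 : 0 < β := by linarith
  have hκzero : κ.LFunction β = 0 := Quadratic.LFunction_eq_zero_of_realZero hκ1 hfac hβ0 hβ1 hkζ
  have h3M : 3 ≤ M := by
    rw [hM]; exact three_le_natAbs_discr k (by rw [hk2]; norm_num)
  -- Step 3: `M = |d_k| ≤ |d_K| = d`
  have hMd : (M : ℝ) ≤ d := by
    have hdvd := natAbs_discr_pow_finrank_dvd k K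
    have hpos : 0 < finrank k K := finrank_pos
    have h1 : (discr k).natAbs ∣ (discr K).natAbs := (dvd_pow_self _ hpos.ne').trans hdvd
    have h2 : (discr k).natAbs ≤ (discr K).natAbs := Nat.le_of_dvd (by omega) h1
    rw [hM, hd]; exact_mod_cast h2
  have hM3 : (3 : ℝ) ≤ M := by exact_mod_cast h3M
  have hM0r : (0 : ℝ) < M := by linarith
  -- Step 4: the mean-value bound for `L(1, κ)`
  set ε' : ℝ := 4 * ε / 5 with hε'def
  have hε'0 : 0 < ε' := by positivity
  have hε'1 : ε' ≤ 1 := by rw [hε'def]; linarith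
  set r : ℝ := ε' / 16 with hrdef
  have hr : 0 < r := by positivity
  have hr1 : r ≤ 1 / 8 := by rw [hrdef]; linarith
  have hrε : r = ε / 20 := by rw [hrdef, hε'def]; ring
  have hβr : 1 - r ≤ β := by rw [hrε]; linarith
  have hmv := norm_LFunction_one_le_of_realZero κ hκ1 hr hr1 hβr hκzero
  set Z : ℝ := ∑' m : ℕ, ((m + 1 : ℕ) : ℝ) ^ (-(1 + 2 * r)) with hZdef
  have hZ0 : 0 ≤ Z := tsum_nonneg fun m ↦ by positivity
  have hZle : Z ≤ 9 / ε' := by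
    have h := tsum_succ_rpow_neg_sub_one_le (δ := 2 * r) (by positivity)
    have e : ∀ m : ℕ, ((m + 1 : ℕ) : ℝ) ^ (-(2 * r) - 1) = ((m + 1 : ℕ) : ℝ) ^ (-(1 + 2 * r)) := by
      intro m; congr 1; ring
    rw [tsum_congr e] at h
    have h1ε : (1 : ℝ) ≤ 1 / ε' := one_le_one_div hε'0 hε'1
    have h8 : 1 / (2 * r) = 8 * (1 / ε') := by rw [hrdef]; field_simp; ring
    have : 1 + 1 / (2 * r) ≤ 9 / ε' := by
      rw [h8, show (9 : ℝ) / ε' = 9 * (1 / ε') by ring]; linarith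
    exact h.trans this
  have hM4r : (M : ℝ) ^ (4 * r) ≤ d ^ (ε' / 4) := by
    rw [show 4 * r = ε' / 4 by rw [hrdef]; ring]
    exact Real.rpow_le_rpow hM0r.le hMd (by positivity)
  have hdq : 0 < d ^ (ε' / 4) := Real.rpow_pos_of_pos hd0 _
  have hL1 : ‖κ.LFunction 1‖ ≤ (1 - β) * (288 * d ^ (ε' / 4) / ε' ^ 2) := by
    have hβ' : 0 ≤ 1 - β := by linarith
    calc ‖κ.LFunction 1‖ ≤ (1 - β) * (2 * (M : ℝ) ^ (4 * r) * Z / r) := hmv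
      _ ≤ (1 - β) * (2 * d ^ (ε' / 4) * (9 / ε') / r) := by
          gcongr
      _ = (1 - β) * (288 * d ^ (ε' / 4) / ε' ^ 2) := by
          rw [hrdef]; field_simp; ring
  -- Step 5: compare with Tatuzawa's threshold at level `ε'`
  have hpow : d ^ (-ε) * d ^ (ε' / 4) = d ^ (-ε') := by
    rw [← Real.rpow_add hd0]; congr 1; rw [hε'def]; ring
  have hMε : d ^ (-ε') ≤ (M : ℝ) ^ (-ε') := Real.rpow_le_rpow_of_nonpos hM0r hMd (by linarith)
  have hfinal : (1 - β) * (288 * d ^ (ε' / 4) / ε' ^ 2) <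
      Estermann.estermannC / (2592 * ballConst) * ε' ^ 3 * d ^ (-ε') := by
    have h1 : (1 - β) * (288 * d ^ (ε' / 4) / ε' ^ 2) <
        C * d ^ (-ε) * (288 * d ^ (ε' / 4) / ε' ^ 2) :=
      mul_lt_mul_of_pos_right hclose (by positivity)
    have h2 : C * d ^ (-ε) * (288 * d ^ (ε' / 4) / ε' ^ 2) ≤
        (Estermann.estermannC / (2592 * ballConst) * ε' ^ 5 / 288) * d ^ (-ε) * (288 * d ^ (ε' / 4) / ε' ^ 2) := by
      gcongr
    have h3 : (Estermann.estermannC / (2592 * ballConst) * ε' ^ 5 / 288) * d ^ (-ε) * (288 * d ^ (ε' / 4) / ε' ^ 2) =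
        Estermann.estermannC / (2592 * ballConst) * ε' ^ 3 * (d ^ (-ε) * d ^ (ε' / 4)) := by
      field_simp
    rw [h3, hpow] at h2
    exact h1.trans_le h2
  calc (κ.LFunction 1).re ≤ ‖κ.LFunction 1‖ := Complex.re_le_norm _
    _ ≤ (1 - β) * (288 * d ^ (ε' / 4) / ε' ^ 2) := hL1
    _ < Estermann.estermannC / (2592 * ballConst) * ε' ^ 3 * d ^ (-ε') := hfinal
    _ ≤ Estermann.estermannC / (2592 * ballConst) * ε' ^ 3 * (M : ℝ) ^ (-ε') :=
        mul_le_mul_of_nonneg_left hMε (by positivity)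

/-- **Same Kronecker character ⇒ same Dedekind zeta function**: if the zeta functions of two number
fields factor on `Re s > 1` as `ζ(s)·L(s,κ)` through the same Dirichlet character `κ`, the two Dedekind
zeta functions (Mathlib's `L`-series `NumberField.dedekindZeta`) are equal — their coefficients agree by
the identity theorem for Dirichlet series (`LSeries.eq_of_LSeries_eventually_eq`). [folklore] -/
theorem dedekindZeta_eq_of_kroneckerChar_eq {k k' : Type*} [Field k] [NumberField k] [Field k']
    [NumberField k'] {M : ℕ} (κ : DirichletCharacter ℂ M)
    (hfac : ∀ s : ℂ, 1 < s.re →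
      NumberField.dedekindZeta k s = riemannZeta s * LSeries (fun m ↦ κ m) s)
    (hfac' : ∀ s : ℂ, 1 < s.re →
      NumberField.dedekindZeta k' s = riemannZeta s * LSeries (fun m ↦ κ m) s) :
    NumberField.dedekindZeta k = NumberField.dedekindZeta k' := by
  set f : ℕ → ℂ := fun m ↦ (Nat.card {I : Ideal (𝓞 k) // Ideal.absNorm I = m} : ℂ) with hf
  set g : ℕ → ℂ := fun m ↦ (Nat.card {I : Ideal (𝓞 k') // Ideal.absNorm I = m} : ℂ) with hg
  have h2 : 1 < (2 : ℂ).re := by norm_num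
  have hfa : LSeries.abscissaOfAbsConv f < ⊤ :=
    (LSeriesSummable_dedekindZeta (K := k) h2).abscissaOfAbsConv_le.trans_lt (by simp)
  have hga : LSeries.abscissaOfAbsConv g < ⊤ :=
    (LSeriesSummable_dedekindZeta (K := k') h2).abscissaOfAbsConv_le.trans_lt (by simp)
  have hev : (fun x : ℝ ↦ LSeries f x) =ᶠ[atTop] fun x ↦ LSeries g x := by
    filter_upwards [Filter.eventually_gt_atTop (1 : ℝ)] with x hx
    have hx' : 1 < (x : ℂ).re := by simpa using hx
    have e1 := hfac x hx'
    have e2 := hfac' x hx'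
    change NumberField.dedekindZeta k x = NumberField.dedekindZeta k' x
    rw [e1, e2]
  have hcoef : ∀ m : ℕ, m ≠ 0 → f m = g m := fun m hm ↦
    LSeries.eq_of_LSeries_eventually_eq hfa hga hev hm
  funext s
  exact LSeries_congr (fun {m} hm ↦ hcoef m hm) s

/-- **The exceptional quadratic field is unique up to isomorphism.**  Let `0 < ε ≤ 1`, and let `K`,
`K'` be number fields of degrees `> 1` with real zeros `β`, `β'` of `ζ_K`, `ζ_{K'}` satisfying
`1 − β < C([K:ℚ],ε)|d_K|^{-ε}`, `1 − β' < C([K':ℚ],ε)|d_{K'}|^{-ε}`.  Then every quadratic subfield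
`k ⊆ K` with `ζ_k(β) = 0` and every quadratic subfield `k' ⊆ K'` with `ζ_{k'}(β') = 0` are isomorphic
(such subfields exist by `exists_quadraticSubfield_tatuzawa_violator`).  Proof: both Kronecker
characters violate Tatuzawa at level `4ε/5`, so they have the same modulus (`tatuzawa_of_ne`) and are
equal (`tatuzawa_sameLevel`); hence `ζ_k = ζ_{k'}`, `k`, `k'` are arithmetically equivalent
(Perlis Thm 1) and, of degree `2 ≤ 6`, isomorphic (Perlis Thm 3). [cite: Tatuzawa1951, Theorem 2]
[cite: Perlis1977, Theorem 1 and Theorem 3] [cite: Stark1974, Theorem 3] -/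
theorem nonempty_algEquiv_quadraticSubfield_of_close_zeros {ε : ℝ} (hε : 0 < ε) (hε1 : ε ≤ 1)
    (K : Type) [Field K] [NumberField K] (hK : 1 < finrank ℚ K)
    (K' : Type) [Field K'] [NumberField K'] (hK' : 1 < finrank ℚ K')
    {β : ℝ} (hβ1 : β < 1)
    (hclose : 1 - β < (Estermann.estermannC / (2592 * ballConst) * ε ^ 5 /
      (1000 * ((finrank ℚ K).factorial : ℝ))) * ((discr K).natAbs : ℝ) ^ (-ε))
    {β' : ℝ} (hβ'1 : β' < 1)
    (hclose' : 1 - β' < (Estermann.estermannC / (2592 * ballConst) * ε ^ 5 /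
      (1000 * ((finrank ℚ K').factorial : ℝ))) * ((discr K').natAbs : ℝ) ^ (-ε))
    (k : IntermediateField ℚ K) (hk2 : finrank ℚ k = 2) (hkζ : dedekindZetaCont k β = 0)
    (k' : IntermediateField ℚ K') (hk'2 : finrank ℚ k' = 2) (hk'ζ : dedekindZetaCont k' β' = 0) :
    Nonempty (k ≃ₐ[ℚ] k') := by
  have hε' : 0 < 4 * ε / 5 := by positivity
  have hε'1 : 4 * ε / 5 ≤ 1 := by linarith
  obtain ⟨M, _, κ, hM, hκ1, hκsq, hκp, hfac⟩ := Quadratic.exists_primitive_kroneckerChar (k := k) hk2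
  obtain ⟨M', _, κ', hM', hκ'1, hκ'sq, hκ'p, hfac'⟩ :=
    Quadratic.exists_primitive_kroneckerChar (k := k') hk'2
  have hv := tatuzawa_violation_of_quadraticSubfield K hK hε hε1 hβ1 hclose k hk2 hkζ κ hκ1 hM hfac
  have hv' :=
    tatuzawa_violation_of_quadraticSubfield K' hK' hε hε1 hβ'1 hclose' k' hk'2 hk'ζ κ' hκ'1 hM' hfac'
  -- same modulus
  have hMM : M = M' := by
    by_contra hne
    rcases tatuzawa_of_ne hε' hε'1 κ hκ1 hκsq hκp κ' hκ'1 hκ'sq hκ'p hne with h | h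
    · exact absurd h hv.not_ge
    · exact absurd h hv'.not_ge
  subst hMM
  -- same character
  have hκκ : κ = κ' := by
    by_contra hne
    rcases tatuzawa_sameLevel hε' hε'1 κ κ' hκ1 hκsq hκ'1 hκ'sq hne with h | h
    · exact absurd h hv.not_ge
    · exact absurd h hv'.not_ge
  subst hκκ
  have hζ : NumberField.dedekindZeta k = NumberField.dedekindZeta k' :=
    dedekindZeta_eq_of_kroneckerChar_eq κ hfac hfac'
  have hAE : ArithmeticallyEquivalent k k' := (Perlis1977_thm1_holds k k').1.mp hζ
  exact Perlis1977_thm3_holds k k' (by rw [hk2]; norm_num) hAE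

/-- **One exceptional quadratic field per scale, up to isomorphism.**  Let `0 < ε ≤ 1` and let `K₁` be
a number field of degree `> 1` with a real zero `β₁ < 1` of `ζ_{K₁}`,
`1 − β₁ < C([K₁:ℚ],ε)|d_{K₁}|^{-ε}`.  Then there is a quadratic subfield `k₁ ⊆ K₁` with `ζ_{k₁}(β₁) = 0`
such that for EVERY number field `K` of degree `n > 1` into which `k₁` does not embed, every real zero
`β < 1` of `ζ_K` satisfies `C(n,ε)·|d_K|^{-ε} ≤ 1 − β` (all constants explicit).
[cite: Tatuzawa1951, Theorem 2] [cite: Stark1974, Theorem 3] [cite: Perlis1977, Theorem 3] -/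
theorem exists_reference_exceptional_quadraticField {ε : ℝ} (hε : 0 < ε) (hε1 : ε ≤ 1)
    (K₁ : Type) [Field K₁] [NumberField K₁] (hK₁ : 1 < finrank ℚ K₁) {β₁ : ℝ} (hβ₁1 : β₁ < 1)
    (h0₁ : dedekindZetaCont K₁ β₁ = 0)
    (hclose₁ : 1 - β₁ < (Estermann.estermannC / (2592 * ballConst) * ε ^ 5 /
      (1000 * ((finrank ℚ K₁).factorial : ℝ))) * ((discr K₁).natAbs : ℝ) ^ (-ε)) :
    ∃ k₁ : IntermediateField ℚ K₁, finrank ℚ k₁ = 2 ∧ dedekindZetaCont k₁ β₁ = 0 ∧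
      ∀ (K : Type) [Field K] [NumberField K], 1 < finrank ℚ K → IsEmpty (k₁ →ₐ[ℚ] K) →
        ∀ β : ℝ, β < 1 → dedekindZetaCont K β = 0 →
          (Estermann.estermannC / (2592 * ballConst) * ε ^ 5 /
              (1000 * ((finrank ℚ K).factorial : ℝ))) * ((discr K).natAbs : ℝ) ^ (-ε) ≤ 1 - β := by
  obtain ⟨k₁, hk₁2, hk₁ζ, -⟩ :=
    exists_quadraticSubfield_tatuzawa_violator K₁ hK₁ hε hε1 hβ₁1 h0₁ hclose₁
  refine ⟨k₁, hk₁2, hk₁ζ, fun K _ _ hK hempty β hβ1 h0 ↦ ?_⟩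
  by_contra hlt
  push Not at hlt
  obtain ⟨k, hk2, hkζ, -⟩ := exists_quadraticSubfield_tatuzawa_violator K hK hε hε1 hβ1 h0 hlt
  obtain ⟨e⟩ := nonempty_algEquiv_quadraticSubfield_of_close_zeros hε hε1 K₁ hK₁ K hK hβ₁1 hclose₁
    hβ1 hlt k₁ hk₁2 hk₁ζ k hk2 hkζ
  exact hempty.false ((k.val).comp e.toAlgHom)

/-! ### Quadratic fields: Tatuzawa's class-number theorem, explicit -/

/-- A quadratic field has only itself as quadratic subfield: every `k ≤ K` with `[k:ℚ] = 2 = [K:ℚ]`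
is `⊤`, so `|d_k| = |d_K|`. [folklore] -/
theorem natAbs_discr_eq_of_finrank_eq_two (K : Type) [Field K] [NumberField K]
    (hK : finrank ℚ K = 2) (k : IntermediateField ℚ K) (hk : finrank ℚ k = 2) :
    (discr k).natAbs = (discr K).natAbs := by
  have htop : k = ⊤ :=
    IntermediateField.eq_of_le_of_finrank_eq le_top (by rw [hk, IntermediateField.finrank_top', hK])
  have e : k ≃ₐ[ℚ] K := (IntermediateField.equivOfEq htop).trans IntermediateField.topEquiv
  rw [NumberField.discr_eq_discr_of_algEquiv _ e]

/-- **Tatuzawa for quadratic fields, explicit**: for `0 < ε ≤ 1` there is `M₀ = M₀(ε) ∈ ℕ` such that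
every quadratic field `K` with `|d_K| ≠ M₀` satisfies
`h_K · R_K ≥ e^{-7}·16^{-2}·(C_T ε⁵/(2000·2))·|d_K|^{1/2−ε}/(2π)²`, `C_T = c_E/(2592 B)`.
[cite: Tatuzawa1951, Theorems 1–2] [cite: MontgomeryVaughan2007, §11.2 Exercise 6] -/
theorem exists_tatuzawa_exceptional_classNumber_mul_regulator_quadratic {ε : ℝ} (hε : 0 < ε)
    (hε1 : ε ≤ 1) :
    ∃ M₀ : ℕ, ∀ (K : Type) [Field K] [NumberField K], finrank ℚ K = 2 → (discr K).natAbs ≠ M₀ →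
      Real.exp (-7) * (1 / 16 : ℝ) ^ 2 *
          (Estermann.estermannC / (2592 * ballConst) * ε ^ 5 / (1000 * (2 : ℕ).factorial) / 2) *
          ((discr K).natAbs : ℝ) ^ (1 / 2 - ε) / (2 * Real.pi) ^ 2 ≤
        (classNumber K : ℝ) * regulator K := by
  obtain ⟨M₀, hM₀⟩ := exists_tatuzawa_exceptional_absDiscr_classNumber hε hε1
  refine ⟨M₀, fun K _ _ hK hne ↦ ?_⟩
  have h := hM₀ K (by rw [hK]; norm_num) (fun k hk ↦ by
    rw [natAbs_discr_eq_of_finrank_eq_two K hK k hk]; exact hne)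
  rw [hK] at h
  exact_mod_cast h

/-- **Tatuzawa's class-number theorem for imaginary quadratic fields, explicit** (his Theorem 1 in
kernel-checked form): for `0 < ε ≤ 1` there is `M₀ = M₀(ε) ∈ ℕ` such that every IMAGINARY quadratic
field `K` (`d_K < 0`, so `R_K = 1`) with `|d_K| ≠ M₀` has
`h_K ≥ e^{-7}·16^{-2}·(C_T ε⁵/4000)·|d_K|^{1/2−ε}/(2π)²`.  The one possible exceptional discriminant is
chosen classically; the constant is explicit and does not depend on it.
[cite: Tatuzawa1951, Theorem 1] [cite: Siegel1935] -/
theorem exists_tatuzawa_exceptional_classNumber_imaginaryQuadratic {ε : ℝ} (hε : 0 < ε) (hε1 : ε ≤ 1) :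
    ∃ M₀ : ℕ, ∀ (K : Type) [Field K] [NumberField K], finrank ℚ K = 2 → discr K < 0 →
      (discr K).natAbs ≠ M₀ →
      Real.exp (-7) * (1 / 16 : ℝ) ^ 2 *
          (Estermann.estermannC / (2592 * ballConst) * ε ^ 5 / (1000 * (2 : ℕ).factorial) / 2) *
          ((discr K).natAbs : ℝ) ^ (1 / 2 - ε) / (2 * Real.pi) ^ 2 ≤ (classNumber K : ℝ) := by
  obtain ⟨M₀, hM₀⟩ := exists_tatuzawa_exceptional_classNumber_mul_regulator_quadratic hε hε1
  refine ⟨M₀, fun K _ _ hK hd hne ↦ ?_⟩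
  have h := hM₀ K hK hne
  rwa [Quadratic.regulator_eq_one_of_discr_neg hK hd, mul_one] at h

end Summit.QuantumAdvantage.QuantumAdvantage.Theorems.DegreeOnePrimesEscape

end
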